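import Summits.QuantumFields.QCD.Theorems.WilsonMobilityGapChiralGluonicCompletionOffsetCertificate

/-!
# `ChiralGluonicCompletion` (crux stmt-QuantumFields-17498) — negative-side calibration: the OFFSET clauses of the
# chirality stub of line `Sketch_ideator5_r2` (card `anomaly-refutes-every-branch`) are not load-bearing as typed

Crux-triage r2 (triager 1), companion to the landed `W`-elimination `AnomalyBranch.offsetCertificateAt_iff` (p153217,
lead c7).  The registered stub `stub_offsetCertificate` asks, regularisation by regularisation, for a branch certificate
`W` (hereditary, refuting the uniform gap) and an OFFSET FUNCTION `M : ℕ → ℝ` with three clauses: (loc) every `M`-null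
branch has a `W`-sub-branch, (mass) cutoffs with `μ ≤ M k` are uniformly gapped at one rate for all positive tuples,
(neg) no eventually-negative offsets.  The card INTENDS `M` to be the PCAC offset of the regularisation, for which (mass)
and (neg) carry physics (one gap rate on massive cutoffs; no labels beyond the chiral line).  As TYPED, `M` is
existential, and the JUNK offset `M k := 1/(k+1) → 0` makes (mass) eventually VACUOUS (`μ ≤ 1/(k+1)` fails eventually)
and (neg) trivial, while (loc) becomes "below EVERY branch there is a `W`-branch".  Hence, after `W`-elimination, the
stub at `reg` is implied by the pure pin statement E** "below every branch of `reg` there is a hereditarily chiral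
branch" (`offsetStub_of_cofinalHereditaryPin`, `offsetCertificateStub_of_cofinalHereditaryPin`) — no gap, no Ward data,
no PCAC offset enter — and it implies E* (`AnomalyBranch.hereditaryPin_of_offsetCertificate`, p153217 §2).  So the typed
stub is sandwiched between two hereditary-pin statements, E** ⇒ stub(reg) ⇒ E*, both of the shape certified underivable
from the crux's hypothesis (p142184 / p144745 / p146141): the anomaly mechanism lives entirely in FIXING `W` and `M`,
which no tree object does.  No statement about lattice QCD is made here. [folklore]
-/

noncomputable section

namespace Summit.QuantumFields.QCD.Theorems.ChiralGluonicCompletion.Negative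

open MeasureTheory Filter Topology
open Literature.MathematicalPhysics.QuantumFieldTheory Literature.MathematicalPhysics.QuantumLattice
  Literature.Probability.LatticeModels
open Summit.QuantumFields.QCD.Theorems.AnomalyBranch

variable {Nf : ℕ}

/-- **Junk offset.**  E** (below every branch a hereditarily chiral branch) ⇒ the `M`-side of the registered stub at
`reg` (the right-hand side of `AnomalyBranch.offsetCertificateAt_iff`), with `M k := 1/(k+1)`: the massive-gap clause
is eventually vacuous and the no-negative-offset clause trivial. -/
theorem offsetStub_of_cofinalHereditaryPin (reg : QCDRegularisation Nf)
    (h : ∀ (φ : ℕ → ℕ) (hφ : StrictMono φ), ∃ ψ : ℕ → ℕ, ∃ hψ : StrictMono ψ, ∀ (θ : ℕ → ℕ) (hθ : StrictMono θ),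
      (((reg.restrict φ hφ.tendsto_atTop).restrict ψ hψ.tendsto_atTop).restrict θ hθ.tendsto_atTop).IsChiralAtZero) :
    ∃ M : ℕ → ℝ,
      (∀ (φ : ℕ → ℕ) (hφ : StrictMono φ), Tendsto (M ∘ φ) atTop (𝓝 0) →
        ∃ ψ : ℕ → ℕ, ∃ hψ : StrictMono ψ, ∀ (θ : ℕ → ℕ) (hθ : StrictMono θ),
          (((reg.restrict φ hφ.tendsto_atTop).restrict ψ hψ.tendsto_atTop).restrict θ hθ.tendsto_atTop).IsChiralAtZero) ∧
      (∀ μ > (0 : ℝ), ∃ Δ > (0 : ℝ), ∀ m : Fin Nf → ℝ, (∀ f, 0 < m f) →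
        ∀ (R R' : ℕ) (A : QCDLatticeObservable Nf R) (B : QCDLatticeObservable Nf R'), ∃ C : ℝ,
          ∀ᶠ k in atTop, μ ≤ M k → ∀ S : ℕ, reg.L k ≤ S → ∀ n : ℕ, n ≤ S →
            ‖qcdLatticeConnectedCorr (reg.β k) (2 * S + 1) (fun fl => (reg.scheme m 0 0).mq fl k) A B n‖ ≤
              C * Real.exp (-(Δ * (reg.a k * n)))) ∧
      (∀ μ > (0 : ℝ), ∀ᶠ k in atTop, -μ < M k) := by
  refine ⟨fun k => 1 / ((k : ℝ) + 1), fun φ hφ _ => h φ hφ, fun μ hμ => ⟨1, one_pos, ?_⟩, fun μ hμ => ?_⟩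
  · intro m _ R R' A B
    refine ⟨0, ?_⟩
    have hev : ∀ᶠ k : ℕ in atTop, 1 / ((k : ℝ) + 1) < μ :=
      (tendsto_one_div_add_atTop_nhds_zero_nat).eventually (gt_mem_nhds hμ)
    exact hev.mono fun k hk hle => absurd hle (not_le.mpr hk)
  · exact Filter.Eventually.of_forall fun k => lt_of_lt_of_le (neg_neg_of_pos hμ) (by positivity)

/-- **E** ⇒ the registered stub body at `reg` in its `∃ W` form** (junk offset + the landed `W`-elimination
`AnomalyBranch.offsetCertificateAt_iff`): an abstract hereditary, gap-refuting certificate `W` and an admissible offset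
function locating it exist as soon as hereditarily chiral branches are cofinal — the typed stub's content over E*/E** is
nil until `W` and `M` are fixed to Ward data and the PCAC offset. -/
theorem offsetCertificateStub_of_cofinalHereditaryPin (reg : QCDRegularisation Nf)
    (h : ∀ (φ : ℕ → ℕ) (hφ : StrictMono φ), ∃ ψ : ℕ → ℕ, ∃ hψ : StrictMono ψ, ∀ (θ : ℕ → ℕ) (hθ : StrictMono θ),
      (((reg.restrict φ hφ.tendsto_atTop).restrict ψ hψ.tendsto_atTop).restrict θ hθ.tendsto_atTop).IsChiralAtZero) :
    ∃ W : QCDRegularisation Nf → Prop,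
      (∀ (r : QCDRegularisation Nf) (ψ : ℕ → ℕ) (hψ : StrictMono ψ), W r → W (r.restrict ψ hψ.tendsto_atTop)) ∧
      (∀ r : QCDRegularisation Nf, W r → r.IsChiralAtZero) ∧
      ∃ M : ℕ → ℝ,
        (∀ (φ : ℕ → ℕ) (hφ : StrictMono φ), Tendsto (M ∘ φ) atTop (𝓝 0) →
          ∃ ψ : ℕ → ℕ, ∃ hψ : StrictMono ψ, W ((reg.restrict φ hφ.tendsto_atTop).restrict ψ hψ.tendsto_atTop)) ∧
        (∀ μ > (0 : ℝ), ∃ Δ > (0 : ℝ), ∀ m : Fin Nf → ℝ, (∀ f, 0 < m f) →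
          ∀ (R R' : ℕ) (A : QCDLatticeObservable Nf R) (B : QCDLatticeObservable Nf R'), ∃ C : ℝ,
            ∀ᶠ k in atTop, μ ≤ M k → ∀ S : ℕ, reg.L k ≤ S → ∀ n : ℕ, n ≤ S →
              ‖qcdLatticeConnectedCorr (reg.β k) (2 * S + 1) (fun fl => (reg.scheme m 0 0).mq fl k) A B n‖ ≤
                C * Real.exp (-(Δ * (reg.a k * n)))) ∧
        (∀ μ > (0 : ℝ), ∀ᶠ k in atTop, -μ < M k) :=
  (offsetCertificateAt_iff reg).2 (offsetStub_of_cofinalHereditaryPin reg h)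

end Summit.QuantumFields.QCD.Theorems.ChiralGluonicCompletion.Negative

end
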